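import Summits.Ventures.YMGap.Thresholds.PressureZeroCouplingDim
import Summits.Ventures.YMGap.Thresholds.CouplingSignFlip
import HarnessLib

/-!
# `SU(2)` on `ℤ^d`, every `d ≥ 2`: the two-sided strong-coupling window `|b| < 1/(6(d-1))` — uniqueness, oddness of the
# plaquette, `C¹` of the free energy density through `b = 0`, `f'(0) = -d(d-1)` (row type C-PRESS, part 9)

Cell `pub-ymgap`, seat ds-1 (gen 9). HONEST FRAMING: strong-coupling LATTICE statements for `SU(2)` Wilson lattice gauge theory on `ℤ^d`,
every `d ≥ 2`, hypothesis-free (Bakry–Émery modulus + staggered centre flip); `C¹` through `b = 0` — NOT analyticity; nothing about the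
continuum or the Clay problem. Kernel theorems only, 0 compute. (Part 7 is the `d = 4` version at the wider Lemma-G window `9/50` and adds
`f''(0)`; here the window is the every-`d` one, `2/(12(d-1))` in the tree coupling.)

* ★ `su2_subsingleton_ymGibbsMeasures_abs_dim` — ONE DLR state at every `|b| ≤ 2/(12(d-1))` (part 3 + `SignFlip.hasUniqueGibbsMeasure_neg`);
* `su2_integral_plaquetteObs_neg_dim` — `⟨Re tr U_p⟩` is odd in `b`; `su2_continuousOn_plaquette_abs_dim`;
* ★★ `su2_hasDerivWithinAt/hasDerivAt_freeEnergyDensity_abs_dim` — `f` differentiable on the closed/open two-sided window,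
  `f' = -Σ_{i<j} (2 - ⟨Re tr U_{p_ij}⟩)`; ★★ `su2_hasDerivAt_freeEnergyDensity_zero_dim` — `HasDerivAt f (-2 · #planes) 0`;
  `su2_contDiffOn_one_freeEnergyDensity_abs_dim` — `f ∈ C¹` on the open two-sided window.
-/

noncomputable section

open MeasureTheory ProbabilityTheory Set Filter Topology
open scoped NNReal
open Literature.MathematicalPhysics.QuantumLattice (LGConfig ZdEdge ZdPlaquette fundamentalRep ymGibbsMeasures
  ymSpecification plaquetteObs plaquetteEdges freeEnergyDensity IsZdTranslationInvariant continuous_fundamentalRep)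
open Literature.MathematicalPhysics.QuantumFieldTheory hiding ZdEdge

namespace Summit.Ventures.YMGap.PressureRegularity

/-! ## H. `SU(2)` on `ℤ^d`, every `d ≥ 2`: the two-sided window `|b| ≤ 1/(6(d-1))`, `C¹` through `b = 0`, `f''(0) = d(d-1)/2` -/

section TwoSidedDim

open Summit.Ventures.YMGap.SignFlip (flip flipEquiv coe_flipEquiv measurable_flip isGibbsMeasure_map_flip
  plaquetteObs_flip hasUniqueGibbsMeasure_neg)

variable {d : ℕ}

/-- Local shorthand: the planes `{(i, j) : i < j}`. -/
local notation3 (prettyPrint := false) "𝔓" d => {q : Fin d × Fin d // q.1 < q.2}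

/-- `SU(2)` is second countable. [folklore] -/
private theorem secondCountable_su2_tsd : SecondCountableTopology (Matrix.specialUnitaryGroup (Fin 2) ℂ) :=
  haveI : SecondCountableTopology (Matrix (Fin 2) (Fin 2) ℂ) :=
    inferInstanceAs (SecondCountableTopology (Fin 2 → Fin 2 → ℂ))
  Topology.IsEmbedding.subtypeVal.secondCountableTopology

/-- ★ **`SU(2)` on `ℤ^d`, two-sided uniqueness**: ONE DLR state at every `|b| ≤ 2/(12(d-1))` (`d ≥ 2`), hypothesis-free — part 3's window
transported by the staggered centre flip. -/
theorem su2_subsingleton_ymGibbsMeasures_abs_dim (hd : 2 ≤ d) {b : ℝ} (hb : |b| ≤ (2 : ℝ) / (12 * ((d : ℝ) - 1))) :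
    (ymGibbsMeasures (d := d) (fundamentalRep (Fin 2)) b).Subsingleton := by
  rcases le_or_gt 0 b with h0 | h0
  · exact subsingleton_ymGibbsMeasures_dim_thooft (N := 2) hd le_rfl ⟨h0, by rwa [abs_of_nonneg h0] at hb⟩
  · have hneg : -b ∈ Icc (0 : ℝ) ((2 : ℝ) / (12 * ((d : ℝ) - 1))) := ⟨by linarith, by rw [abs_of_neg h0] at hb; exact hb⟩
    obtain ⟨ν, hν⟩ := CouplingResponse.exists_dlrSelection_dim (d := d) (N := 2)
    have hu : Literature.Probability.LatticeModels.HasUniqueGibbsMeasure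
        (ymSpecification (d := d) (fundamentalRep (Fin 2)) (-b)) :=
      ⟨by exact_mod_cast subsingleton_ymGibbsMeasures_dim_thooft (N := 2) hd le_rfl hneg, ⟨ν (-b), hν (-b)⟩⟩
    have h := hasUniqueGibbsMeasure_neg (d := d) hu
    rw [neg_neg] at h
    exact h.1

/-- Oddness of the plaquette expectation on `ℤ^d`: `⟨Re tr U_p⟩_{𝒢(-b)} = -⟨Re tr U_p⟩_{𝒢(b)}`, `|b| ≤ 2/(12(d-1))`. -/
theorem su2_integral_plaquetteObs_neg_dim (hd : 2 ≤ d) {b : ℝ} (hb : |b| ≤ (2 : ℝ) / (12 * ((d : ℝ) - 1)))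
    {ν ν' : Measure (LGConfig d (Matrix.specialUnitaryGroup (Fin 2) ℂ))}
    (hν : ν ∈ ymGibbsMeasures (d := d) (fundamentalRep (Fin 2)) (-b))
    (hν' : ν' ∈ ymGibbsMeasures (d := d) (fundamentalRep (Fin 2)) b) (p : ZdPlaquette d) :
    ∫ U, plaquetteObs (fundamentalRep (Fin 2)) p.1 p.2.1.1 p.2.1.2 U ∂ν =
      -∫ U, plaquetteObs (fundamentalRep (Fin 2)) p.1 p.2.1.1 p.2.1.2 U ∂ν' := by
  have h1 : ν'.map flip ∈ ymGibbsMeasures (d := d) (fundamentalRep (Fin 2)) (-b) := isGibbsMeasure_map_flip (d := d) hν'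
  have h2 : ν = ν'.map flip := su2_subsingleton_ymGibbsMeasures_abs_dim hd (by rwa [abs_neg]) hν h1
  rw [h2, ← coe_flipEquiv, integral_map_equiv, ← integral_neg]
  refine integral_congr_ae (ae_of_all _ fun U => ?_)
  simp only [coe_flipEquiv, plaquetteObs_flip U p.1 (ne_of_lt p.2.2)]

/-- Continuity of every plaquette expectation of THE state on the two-sided window of `ℤ^d`. -/
theorem su2_continuousOn_plaquette_abs_dim (hd : 2 ≤ d)
    {μ : ℝ → Measure (LGConfig d (Matrix.specialUnitaryGroup (Fin 2) ℂ))}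
    (hμ : ∀ b ∈ Icc (-((2 : ℝ) / (12 * ((d : ℝ) - 1)))) ((2 : ℝ) / (12 * ((d : ℝ) - 1))),
      μ b ∈ ymGibbsMeasures (d := d) (fundamentalRep (Fin 2)) b)
    (p : ZdPlaquette d) :
    ContinuousOn (fun b => ∫ U, plaquetteObs (fundamentalRep (Fin 2)) p.1 p.2.1.1 p.2.1.2 U ∂(μ b))
      (Icc (-((2 : ℝ) / (12 * ((d : ℝ) - 1)))) ((2 : ℝ) / (12 * ((d : ℝ) - 1)))) := by
  haveI := secondCountable_su2_tsd
  set b₁ : ℝ := (2 : ℝ) / (12 * ((d : ℝ) - 1)) with hb₁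
  have hd' : (2 : ℝ) ≤ d := by exact_mod_cast hd
  have hb₁0 : 0 ≤ b₁ := div_nonneg (by norm_num) (by nlinarith)
  have hμp : ∀ b ∈ Icc (0 : ℝ) b₁, μ b ∈ ymGibbsMeasures (d := d) (fundamentalRep (Fin 2)) b :=
    fun b hb => hμ b ⟨by linarith [hb.1], hb.2⟩
  -- right half: C-LIP (every-d door), scaled `Re tr = 2 W`
  obtain ⟨h1, hK0, hdoor⟩ := CouplingResponse.bakryEmery_door_dim (N := 2) hd (by norm_num)
  have hcz : ContinuousOn (fun b => ∫ U, zdPlaquetteObs (fundamentalRep (Fin 2)) p.1 p.2.1.1 p.2.1.2 U ∂(μ b)) (Icc (0 : ℝ) b₁) :=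
    CouplingResponse.continuousOn_integral_dim hd (by norm_num) hK0
      (Literature.MathematicalPhysics.QuantumFieldTheory.Balaban1983to89.StrongCouplingKernelWindow.oneLinkKRModulus_SU le_rfl h1)
      le_rfl hdoor hμp (isLipschitzCylinder_zdPlaquetteObs (N := 2) p.1 p.2.2) (x₀ := p.1) (D := 1)
      (fun e he => by simpa using norm_fst_sub_le_of_mem_plaquetteEdges he)
  have hright : ContinuousOn (fun b => ∫ U, plaquetteObs (fundamentalRep (Fin 2)) p.1 p.2.1.1 p.2.1.2 U ∂(μ b)) (Icc (0 : ℝ) b₁) :=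
    ((continuousOn_const (c := ((2 : ℕ) : ℝ))).mul hcz).congr fun b _ => integral_plaquetteObs_eq_mul p (μ b)
  have hleft_eq : ∀ b ∈ Icc (-b₁) 0,
      -∫ U, plaquetteObs (fundamentalRep (Fin 2)) p.1 p.2.1.1 p.2.1.2 U ∂(μ (-b)) =
        ∫ U, plaquetteObs (fundamentalRep (Fin 2)) p.1 p.2.1.1 p.2.1.2 U ∂(μ b) := fun b hb => by
    have hbb : |(-b)| ≤ b₁ := by rw [abs_neg, abs_of_nonpos hb.2]; linarith [hb.1]
    have h := su2_integral_plaquetteObs_neg_dim hd hbb (ν := μ b) (ν' := μ (-b))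
      (by rw [neg_neg]; exact hμ b ⟨hb.1, by linarith [hb.2]⟩) (hμp (-b) ⟨by linarith [hb.2], by linarith [hb.1]⟩) p
    rw [h]
  have hleft : ContinuousOn (fun b => ∫ U, plaquetteObs (fundamentalRep (Fin 2)) p.1 p.2.1.1 p.2.1.2 U ∂(μ b)) (Icc (-b₁) 0) := by
    have hc : ContinuousOn
        ((fun b => ∫ U, plaquetteObs (fundamentalRep (Fin 2)) p.1 p.2.1.1 p.2.1.2 U ∂(μ b)) ∘ fun b : ℝ => -b) (Icc (-b₁) 0) :=
      hright.comp continuous_neg.continuousOn fun b hb => ⟨by linarith [hb.2], by linarith [hb.1]⟩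
    exact hc.neg.congr fun b hb => (hleft_eq b hb).symm
  have h := hleft.union_of_isClosed hright isClosed_Icc isClosed_Icc
  rwa [Icc_union_Icc_eq_Icc (by linarith) hb₁0] at h

/-- ★★ **`SU(2)` on `ℤ^d`, every `d ≥ 2`, TWO-SIDED: the free energy density is differentiable at every `|b| ≤ 2/(12(d-1))`** (within the
closed window), derivative `-Σ_{i<j} (2 - ⟨Re tr U_{p_ij}⟩_{μ b})`, along any DLR selection. -/
theorem su2_hasDerivWithinAt_freeEnergyDensity_abs_dim (hd : 2 ≤ d)
    {μ : ℝ → Measure (LGConfig d (Matrix.specialUnitaryGroup (Fin 2) ℂ))}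
    (hμ : ∀ b ∈ Icc (-((2 : ℝ) / (12 * ((d : ℝ) - 1)))) ((2 : ℝ) / (12 * ((d : ℝ) - 1))),
      μ b ∈ ymGibbsMeasures (d := d) (fundamentalRep (Fin 2)) b)
    {b : ℝ} (hb : b ∈ Icc (-((2 : ℝ) / (12 * ((d : ℝ) - 1)))) ((2 : ℝ) / (12 * ((d : ℝ) - 1)))) :
    HasDerivWithinAt (freeEnergyDensity d (fundamentalRep (Fin 2)))
      (-∑ q : 𝔓 d, ((2 : ℝ) - ∫ U, plaquetteObs (fundamentalRep (Fin 2)) 0 q.1.1 q.1.2 U ∂(μ b)))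
      (Icc (-((2 : ℝ) / (12 * ((d : ℝ) - 1)))) ((2 : ℝ) / (12 * ((d : ℝ) - 1)))) b := by
  haveI := secondCountable_su2_tsd
  have h := hasDerivWithinAt_freeEnergyDensity (d := d) (fundamentalRep (Fin 2)) (continuous_fundamentalRep _) hμ
    (fun t ht => isZdTranslationInvariant_of_subsingleton _ (continuous_fundamentalRep _)
      (su2_subsingleton_ymGibbsMeasures_abs_dim hd (abs_le.2 ⟨by linarith [ht.1], ht.2⟩)) (hμ t ht)) hb
    fun q => su2_continuousOn_plaquette_abs_dim hd hμ ((0 : Literature.Probability.LatticeModels.Site d), q) b hb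
  simpa using h

/-- ★★ **`SU(2)` on `ℤ^d`: `HasDerivAt` on the open two-sided window**, in particular AT `b = 0`. -/
theorem su2_hasDerivAt_freeEnergyDensity_abs_dim (hd : 2 ≤ d)
    {μ : ℝ → Measure (LGConfig d (Matrix.specialUnitaryGroup (Fin 2) ℂ))}
    (hμ : ∀ b ∈ Icc (-((2 : ℝ) / (12 * ((d : ℝ) - 1)))) ((2 : ℝ) / (12 * ((d : ℝ) - 1))),
      μ b ∈ ymGibbsMeasures (d := d) (fundamentalRep (Fin 2)) b)
    {b : ℝ} (hb : b ∈ Ioo (-((2 : ℝ) / (12 * ((d : ℝ) - 1)))) ((2 : ℝ) / (12 * ((d : ℝ) - 1)))) :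
    HasDerivAt (freeEnergyDensity d (fundamentalRep (Fin 2)))
      (-∑ q : 𝔓 d, ((2 : ℝ) - ∫ U, plaquetteObs (fundamentalRep (Fin 2)) 0 q.1.1 q.1.2 U ∂(μ b))) b :=
  (su2_hasDerivWithinAt_freeEnergyDensity_abs_dim hd hμ (Ioo_subset_Icc_self hb)).hasDerivAt (Icc_mem_nhds hb.1 hb.2)

/-- ★★ **`SU(2)` on `ℤ^d`, every `d ≥ 2`: `f'(0) = -2 · #planes = -d(d-1)`, TWO-SIDED.** -/
theorem su2_hasDerivAt_freeEnergyDensity_zero_dim (hd : 2 ≤ d) :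
    HasDerivAt (freeEnergyDensity d (fundamentalRep (Fin 2))) (-(2 * (Fintype.card (𝔓 d) : ℝ))) 0 := by
  classical
  haveI := secondCountable_su2_tsd
  have hd' : (2 : ℝ) ≤ d := by exact_mod_cast hd
  have hb₁0 : 0 < (2 : ℝ) / (12 * ((d : ℝ) - 1)) := div_pos (by norm_num) (by nlinarith)
  obtain ⟨ν, hν⟩ := CouplingResponse.exists_dlrSelection_dim (d := d) (N := 2)
  have h := su2_hasDerivAt_freeEnergyDensity_abs_dim hd (fun b _ => hν b) (b := 0) ⟨by linarith, hb₁0⟩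
  have hplaq : ∀ q : 𝔓 d, ∫ U, plaquetteObs (fundamentalRep (Fin 2)) 0 q.1.1 q.1.2 U ∂(ν 0) = 0 := fun q => by
    rw [integral_plaquetteObs_eq_mul ((0 : Literature.Probability.LatticeModels.Site d), q) (ν 0),
      eq_zdHaar_of_mem_zero_dim hd le_rfl (hν 0),
      integral_zdPlaquetteObs_zdHaar (TorusAreaLaw.isSpecialUnitaryModel_fundamentalRep 2) le_rfl
        ((0 : Literature.Probability.LatticeModels.Site d), q), mul_zero]
  simp only [hplaq, sub_zero, Finset.sum_const, Finset.card_univ, nsmul_eq_mul] at h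
  refine h.congr_deriv ?_
  ring

/-- ★ **`f ∈ C¹` on the open two-sided window of `ℤ^d`** (every `d ≥ 2`). -/
theorem su2_contDiffOn_one_freeEnergyDensity_abs_dim (hd : 2 ≤ d) :
    ContDiffOn ℝ 1 (freeEnergyDensity d (fundamentalRep (Fin 2)))
      (Ioo (-((2 : ℝ) / (12 * ((d : ℝ) - 1)))) ((2 : ℝ) / (12 * ((d : ℝ) - 1)))) := by
  obtain ⟨ν, hν⟩ := CouplingResponse.exists_dlrSelection_dim (d := d) (N := 2)
  refine CouplingResponse.contDiffOn_one_of_hasDerivAt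
    (fun t ht => su2_hasDerivAt_freeEnergyDensity_abs_dim hd (fun b _ => hν b) ht) ?_
  exact (continuousOn_finsetSum _ fun q _ => continuousOn_const.sub
    (su2_continuousOn_plaquette_abs_dim hd (fun b _ => hν b) ((0 : Literature.Probability.LatticeModels.Site d), q))).neg

end TwoSidedDim

end Summit.Ventures.YMGap.PressureRegularity

end
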